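import Literature.AlgebraicGeometry.Resolution.DifferentialOperators
import Mathlib.RingTheory.AdicCompletion.Algebra
import HarnessLib

/-!
# Differential operators extend to the adic completion

Topic: `Literature/AlgebraicGeometry/Resolution` (Grothendieck differential operators `IsDiffOpLE`, file
`DifferentialOperators.lean`). Let `R → A` be commutative rings, `I ⊂ A` an ideal, `Â = AdicCompletion I A`
(Mathlib: compatible families in `∏ₖ A/I^k`) and `D : A → A` an `R`-linear differential operator of order `≤ n`
(EGA IV₄ 16.8.8 (b): all `(n+1)`-fold iterated commutators with multiplications vanish). Since `D(I^{k+n}) ⊆ I^k`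
(tree `IsDiffOpLE.apply_mem_pow_sub`, the higher Leibniz estimate), `D` is `I`-adically continuous and induces
level maps `A/I^{k+n} → A/I^k`; these assemble to an `R`-linear map `D̂ : Â → Â` with `D̂ ∘ ι = ι ∘ D`
(`ι = AdicCompletion.of`). We PROVE (`IsDiffOpLE.exists_adicCompletion`) that `D̂` is again a differential
operator of order `≤ n`, relative to `R`, on the ring `Â` — EGA IV₄ 16.8.9-style continuity/extension of
differential operators to completions ([EGAIV4, Prop. 16.8.8 (b)] for the notion; the extension statement is
folklore, cf. [Matsumura1987, §30 Exercise / Thm. 30.6 context] for derivations; here proved from scratch).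

The proof of the order bound uses two facts of independent interest:
* `isDiffOpLE_iff_forall_list` — EGA IV₄ 16.8.8 (c): order `≤ n` iff every `(n+1)`-fold iterated commutator
  `[[…[G, h₀], h₁]…, h_n]` (`List.foldl`) vanishes; and the commutator swap
  `[[G, a], b] = [[G, b], a]` (`commMul_commMul_comm`);
* a LEVELWISE criterion on `Â` (`isDiffOpLE_of_forall_list_of`): if `G : Â → Â` is computed levelwise — the
  `k`-th component of `G f` is a function of the `(k+m)`-th component of `f` — then the iterated commutators may
  be taken with elements `ι(r)`, `r ∈ A`, only (every component of `h ∈ Â` is represented by some `r`).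
Also: `IsDiffOpLE.conj_algEquiv` — transport of the order bound along an `R`-algebra isomorphism.

No definitions are introduced (constructions are internal to the proofs; the levelwise property is carried as
an explicit hypothesis). Motivation (cell `res-hironaka`, HIRONAKA-L lane; nothing about the manuscript is
asserted here): Hironaka 2017 §7.4 p.39 l.37–40 reads the elementary differential operators of `O_η` inside the
completion `Ô_η = K(η)[[x − a]]` (typed consumer `Hironaka2017.S07Permissible.U39L37_perf`).
-/

namespace Literature.AlgebraicGeometry.Resolution

universe u v w

/-! ## Iterated commutators: EGA IV₄ 16.8.8 (c) and the commutator swap -/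

section Iterated

variable {R : Type u} {B : Type v} [CommRing R] [CommRing B] [Algebra R B]

/-- **Commutator swap**: `[[G, a], b] = [[G, b], a]` (multiplications commute with each other).
[cite: EGAIV4, Prop. 16.8.8 (16.8.8.1)] -/
theorem commMul_commMul_comm (G : B →ₗ[R] B) (a b : B) :
    commMul R (commMul R G a) b = commMul R (commMul R G b) a := by
  ext t
  simp only [commMul_apply]
  ring_nf

/-- Moving the first commutator to the end of an iterated commutator:
`[[…[[G, h], a₁]…], a_k] = [[…[G, a₁]…, a_k], h]`. [cite: EGAIV4, Prop. 16.8.8 (c)] -/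
theorem foldl_commMul_commMul (G : B →ₗ[R] B) (h : B) (hs : List B) :
    hs.foldl (fun G a => commMul R G a) (commMul R G h) =
      commMul R (hs.foldl (fun G a => commMul R G a) G) h := by
  induction hs generalizing G with
  | nil => rfl
  | cons a hs ih => rw [List.foldl_cons, List.foldl_cons, commMul_commMul_comm, ih]

/-- **EGA IV₄ 16.8.8 (c)**: `G` is a differential operator of order `≤ n` iff every `(n+1)`-fold iterated
commutator `[[…[G, h₀], h₁]…, h_n]` with multiplications vanishes. [cite: EGAIV4, Prop. 16.8.8 (c)] -/
theorem isDiffOpLE_iff_forall_list :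
    ∀ {n : ℕ} {G : B →ₗ[R] B}, IsDiffOpLE R n G ↔
      ∀ hs : List B, hs.length = n + 1 → hs.foldl (fun G a => commMul R G a) G = 0
  | 0, G => by
    refine ⟨fun hG hs hlen => ?_, fun H a => ?_⟩
    · match hs, hlen with
      | [h], _ => simpa using hG h
    · simpa using H [a] rfl
  | n + 1, G => by
    rw [isDiffOpLE_succ_iff]
    refine ⟨fun hG hs hlen => ?_, fun H a => ?_⟩
    · match hs, hlen with
      | h :: hs, hlen =>
        rw [List.foldl_cons]
        exact (isDiffOpLE_iff_forall_list.mp (hG h)) hs (by simpa using hlen)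
    · refine isDiffOpLE_iff_forall_list.mpr fun hs hlen => ?_
      have := H (a :: hs) (by simpa using hlen)
      rwa [List.foldl_cons] at this

end Iterated

/-! ## Transport along algebra isomorphisms -/

section Transport

variable {R : Type u} {B : Type v} {C : Type w} [CommRing R] [CommRing B] [CommRing C]
  [Algebra R B] [Algebra R C]

/-- Conjugating by an `R`-algebra isomorphism `e : B ≃ C` commutes with taking commutators:
`[e G e⁻¹, c] = e [G, e⁻¹ c] e⁻¹`. [cite: EGAIV4, Prop. 16.8.8 (16.8.8.1)] -/
theorem commMul_conj_algEquiv (e : B ≃ₐ[R] C) (G : B →ₗ[R] B) (c : C) :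
    commMul R (e.toLinearMap ∘ₗ G ∘ₗ e.symm.toLinearMap) c =
      e.toLinearMap ∘ₗ commMul R G (e.symm c) ∘ₗ e.symm.toLinearMap := by
  ext t
  simp only [commMul_apply, LinearMap.comp_apply, AlgEquiv.toLinearMap_apply, map_sub, map_mul,
    AlgEquiv.apply_symm_apply]

/-- **The order of a differential operator is invariant under `R`-algebra isomorphisms**: if `G` has order
`≤ n` on `B` then `e ∘ G ∘ e⁻¹` has order `≤ n` on `C`. [cite: EGAIV4, Prop. 16.8.8 (b)] -/
theorem IsDiffOpLE.conj_algEquiv (e : B ≃ₐ[R] C) :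
    ∀ {n : ℕ} {G : B →ₗ[R] B}, IsDiffOpLE R n G →
      IsDiffOpLE R n (e.toLinearMap ∘ₗ G ∘ₗ e.symm.toLinearMap)
  | 0, G, hG => fun c => by
    rw [commMul_conj_algEquiv, hG (e.symm c)]
    ext t; simp
  | n + 1, G, hG => fun c => by
    rw [commMul_conj_algEquiv]
    exact IsDiffOpLE.conj_algEquiv e (hG (e.symm c))

end Transport

/-! ## Levelwise maps of the adic completion -/

section Levelwise

open AdicCompletion

variable {R : Type u} {A : Type v} [CommRing R] [CommRing A] [Algebra R A] {I : Ideal A}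

/-- Components of an element of `Â` are compatible under the transition maps (restated with explicit levels).
[folklore] -/
private theorem val_transition (f : AdicCompletion I A) {j k : ℕ} (hjk : j ≤ k) :
    transitionMap I A hjk (f.val k) = f.val j :=
  f.property hjk

/-- Every component of an element of `Â = lim A/I^k` is the class of a ring element. [folklore] -/
private theorem exists_val_eq_mk (f : AdicCompletion I A) (k : ℕ) :
    ∃ r : A, f.val k = Submodule.Quotient.mk r :=
  Quotient.inductionOn' (f.val k) fun r => ⟨r, rfl⟩

/-- If the `(k+m)`-th component of `h ∈ Â` is the class of `r ∈ A`, so is its `k`-th component. [folklore] -/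
private theorem val_eq_mk_of_le {h : AdicCompletion I A} {k l : ℕ} (hkl : k ≤ l) {r : A}
    (hr : h.val l = Submodule.Quotient.mk r) : h.val k = Submodule.Quotient.mk r := by
  rw [← val_transition h hkl, hr]
  rfl

/-- The commutator of a LEVELWISE map `G` (the `k`-th component of `G f` is `g k` of the `(k+m)`-th component of
`f`) with the multiplication by `h ∈ Â` is levelwise, with `k`-th level function
`q ↦ g k (h_{k+m} q) − h_k g k (q)`. [folklore] -/
private theorem levelwise_commMul {m : ℕ} {G : AdicCompletion I A →ₗ[R] AdicCompletion I A}
    {g : ∀ k, A ⧸ (I ^ (k + m) • ⊤ : Submodule A A) → A ⧸ (I ^ k • ⊤ : Submodule A A)}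
    (hG : ∀ (f : AdicCompletion I A) (k : ℕ), (G f).val k = g k (f.val (k + m)))
    (h f : AdicCompletion I A) (k : ℕ) :
    (commMul R G h f).val k = g k (h.val (k + m) * f.val (k + m)) - h.val k * g k (f.val (k + m)) := by
  rw [commMul_apply, val_sub_apply, hG, val_mul, val_mul, hG]

/-- **Levelwise maps: iterated commutators may be computed with ring elements.** Let `G, G'` be levelwise maps
of `Â` (shift `m`) whose level functions agree at level `k`, and let `hs ⊂ Â`, `rs ⊂ A` be lists matched by
«the `(k+m)`-th component of `hᵢ` is the class of `rᵢ`». Then the iterated commutators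
`[[…[G, h₀]…], h_j]` and `[[…[G', ι r₀]…], ι r_j]` are levelwise and agree at level `k`. [folklore] -/
private theorem foldl_levelwise_match {m k : ℕ} :
    ∀ {hs : List (AdicCompletion I A)} {rs : List A},
      List.Forall₂ (fun h r => h.val (k + m) = Submodule.Quotient.mk r) hs rs →
      ∀ {G G' : AdicCompletion I A →ₗ[R] AdicCompletion I A}
        {g g' : ∀ k, A ⧸ (I ^ (k + m) • ⊤ : Submodule A A) → A ⧸ (I ^ k • ⊤ : Submodule A A)},
        (∀ (f : AdicCompletion I A) (k : ℕ), (G f).val k = g k (f.val (k + m))) →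
        (∀ (f : AdicCompletion I A) (k : ℕ), (G' f).val k = g' k (f.val (k + m))) →
        g k = g' k →
        ∃ γ γ' : ∀ k, A ⧸ (I ^ (k + m) • ⊤ : Submodule A A) → A ⧸ (I ^ k • ⊤ : Submodule A A),
          (∀ (f : AdicCompletion I A) (k : ℕ),
              (hs.foldl (fun G a => commMul R G a) G f).val k = γ k (f.val (k + m))) ∧
          (∀ (f : AdicCompletion I A) (k : ℕ),
              (rs.foldl (fun G r => commMul R G (of I A r)) G' f).val k = γ' k (f.val (k + m))) ∧
          γ k = γ' k
  | [], [], _, G, G', g, g', hG, hG', hk => ⟨g, g', hG, hG', hk⟩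
  | h :: hs, r :: rs, hmatch, G, G', g, g', hG, hG', hk => by
    obtain ⟨hr, hmatch'⟩ := List.forall₂_cons.mp hmatch
    rw [List.foldl_cons, List.foldl_cons]
    refine foldl_levelwise_match hmatch'
      (g := fun j q => g j (h.val (j + m) * q) - h.val j * g j q)
      (g' := fun j q => g' j ((of I A r).val (j + m) * q) - (of I A r).val j * g' j q)
      (levelwise_commMul hG h) (levelwise_commMul hG' (of I A r)) ?_
    funext q
    simp only [hk, of_apply, Submodule.mkQ_apply, hr, val_eq_mk_of_le (Nat.le_add_right k m) hr]

/-- **Levelwise criterion for the order of a differential operator on `Â`.** If `G : Â → Â` is levelwise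
(shift `m`) and every `(n+1)`-fold iterated commutator of `G` with multiplications by elements `ι(r)`, `r ∈ A`,
vanishes, then `G` is a differential operator of order `≤ n` relative to `R`. [cite: EGAIV4, Prop. 16.8.8 (c)] -/
theorem isDiffOpLE_of_forall_list_of {m : ℕ} {G : AdicCompletion I A →ₗ[R] AdicCompletion I A}
    {g : ∀ k, A ⧸ (I ^ (k + m) • ⊤ : Submodule A A) → A ⧸ (I ^ k • ⊤ : Submodule A A)}
    (hG : ∀ (f : AdicCompletion I A) (k : ℕ), (G f).val k = g k (f.val (k + m))) {n : ℕ}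
    (H : ∀ rs : List A, rs.length = n + 1 → rs.foldl (fun G r => commMul R G (of I A r)) G = 0) :
    IsDiffOpLE R n G := by
  refine isDiffOpLE_iff_forall_list.mpr fun hs hlen => ?_
  ext f k
  -- represent the `(k+m)`-th components of the `hᵢ` by ring elements
  have hex : ∃ rs : List A, List.Forall₂ (fun h r => h.val (k + m) = Submodule.Quotient.mk r) hs rs := by
    clear hlen
    induction hs with
    | nil => exact ⟨[], List.Forall₂.nil⟩
    | cons h hs ih =>
      obtain ⟨rs, hrs⟩ := ih
      obtain ⟨r, hr⟩ := exists_val_eq_mk h (k + m)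
      exact ⟨r :: rs, List.Forall₂.cons hr hrs⟩
  obtain ⟨rs, hrs⟩ := hex
  obtain ⟨γ, γ', hγ, hγ', hk⟩ := foldl_levelwise_match hrs hG hG rfl
  rw [LinearMap.zero_apply, val_zero_apply, hγ, hk, ← hγ', H rs (hrs.length_eq ▸ hlen), LinearMap.zero_apply,
    val_zero_apply]

end Levelwise

/-! ## The extension `D̂` of a differential operator to `Â` -/

section Extension

open AdicCompletion

variable {R : Type u} {A : Type v} [CommRing R] [CommRing A] [Algebra R A] (I : Ideal A)

/-- Membership in `I^k • ⊤ ⊂ A` is membership in `I^k`. [folklore] -/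
private theorem pow_smul_top_mem_iff {k : ℕ} {x : A} :
    x ∈ (I ^ k • ⊤ : Submodule A A) ↔ x ∈ I ^ k := by
  rw [Ideal.smul_eq_mul, Ideal.mul_top]

/-- **Extension of a differential operator to the adic completion, levelwise form.** If `D : A → A` is
`R`-linear with `D(I^{k+m}) ⊆ I^k` for all `k`, there is an `R`-linear `D̂ : Â → Â` with `D̂ ∘ ι = ι ∘ D`, computed
levelwise: the `k`-th component of `D̂ f` is the class of `D s` for any `s` representing the `(k+m)`-th component
of `f`. [cite: EGAIV4, Prop. 16.8.8 (b)] -/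
theorem exists_adicCompletion_extension_levelwise {m : ℕ} (D : A →ₗ[R] A)
    (hDm : ∀ (k : ℕ) (x : A), x ∈ I ^ (k + m) → D x ∈ I ^ k) :
    ∃ (G : AdicCompletion I A →ₗ[R] AdicCompletion I A)
      (g : ∀ k, A ⧸ (I ^ (k + m) • ⊤ : Submodule A A) → A ⧸ (I ^ k • ⊤ : Submodule A A)),
      (∀ (f : AdicCompletion I A) (k : ℕ), (G f).val k = g k (f.val (k + m))) ∧
      (∀ (k : ℕ) (s : A), g k (Submodule.Quotient.mk s) = Submodule.Quotient.mk (D s)) ∧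
      ∀ x : A, G (of I A x) = of I A (D x) := by
  -- the level maps
  let g : ∀ k, A ⧸ (I ^ (k + m) • ⊤ : Submodule A A) → A ⧸ (I ^ k • ⊤ : Submodule A A) := fun k =>
    Quotient.lift (s := Submodule.quotientRel _) (fun s : A => Submodule.Quotient.mk (D s))
      (fun a b hab => by
        have hab' : a - b ∈ (I ^ (k + m) • ⊤ : Submodule A A) :=
          (Submodule.Quotient.eq _).mp
            (Quotient.sound hab : (Submodule.Quotient.mk a : A ⧸ (I ^ (k + m) • ⊤ : Submodule A A)) =
              Submodule.Quotient.mk b)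
        rw [pow_smul_top_mem_iff] at hab'
        rw [Submodule.Quotient.eq, ← map_sub, pow_smul_top_mem_iff]
        exact hDm k _ hab')
  have hg : ∀ (k : ℕ) (s : A), g k (Submodule.Quotient.mk s) = Submodule.Quotient.mk (D s) :=
    fun k s => rfl
  -- the levelwise map, as a function
  let Gf : AdicCompletion I A → AdicCompletion I A := fun f =>
    ⟨fun k => g k (f.val (k + m)), fun {j k} hjk => by
      obtain ⟨s, hs⟩ := exists_val_eq_mk f (k + m)
      have hs' : f.val (j + m) = Submodule.Quotient.mk s := by
        rw [← f.property (Nat.add_le_add_right hjk m), hs]; rfl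
      change transitionMap I A hjk (g k (f.val (k + m))) = g j (f.val (j + m))
      rw [hs, hs', hg, hg]
      rfl⟩
  have hGf : ∀ f k, (Gf f).val k = g k (f.val (k + m)) := fun f k => rfl
  -- linearity
  refine ⟨{ toFun := Gf, map_add' := fun f₁ f₂ => ?_, map_smul' := fun c f => ?_ }, g,
    fun f k => rfl, hg, fun x => ?_⟩
  · ext k
    rw [val_add_apply, hGf, hGf, hGf, val_add_apply]
    obtain ⟨s₁, hs₁⟩ := exists_val_eq_mk f₁ (k + m)
    obtain ⟨s₂, hs₂⟩ := exists_val_eq_mk f₂ (k + m)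
    rw [hs₁, hs₂, ← Submodule.Quotient.mk_add, hg, hg, hg, map_add, Submodule.Quotient.mk_add]
  · ext k
    rw [RingHom.id_apply, val_smul_apply, hGf, hGf, val_smul_apply]
    obtain ⟨s, hs⟩ := exists_val_eq_mk f (k + m)
    rw [hs, ← Submodule.Quotient.mk_smul, hg, hg, map_smul, Submodule.Quotient.mk_smul]
  · ext k
    change (Gf (of I A x)).val k = _
    rw [hGf, of_apply, of_apply, Submodule.mkQ_apply, Submodule.mkQ_apply, hg]

variable {I}

/-- The commutator of a levelwise extension with `ι(r)` is the levelwise extension of the commutator: level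
functions. [folklore] -/
private theorem levelwise_commMul_of {m : ℕ} {D : A →ₗ[R] A}
    {G : AdicCompletion I A →ₗ[R] AdicCompletion I A}
    {g : ∀ k, A ⧸ (I ^ (k + m) • ⊤ : Submodule A A) → A ⧸ (I ^ k • ⊤ : Submodule A A)}
    (hG : ∀ (f : AdicCompletion I A) (k : ℕ), (G f).val k = g k (f.val (k + m)))
    (hg : ∀ (k : ℕ) (s : A), g k (Submodule.Quotient.mk s) = Submodule.Quotient.mk (D s)) (r : A) :
    ∃ g' : ∀ k, A ⧸ (I ^ (k + m) • ⊤ : Submodule A A) → A ⧸ (I ^ k • ⊤ : Submodule A A),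
      (∀ (f : AdicCompletion I A) (k : ℕ), (commMul R G (of I A r) f).val k = g' k (f.val (k + m))) ∧
      ∀ (k : ℕ) (s : A), g' k (Submodule.Quotient.mk s) = Submodule.Quotient.mk (commMul R D r s) := by
  refine ⟨fun k q => g k ((of I A r).val (k + m) * q) - (of I A r).val k * g k q,
    levelwise_commMul hG (of I A r), fun k s => ?_⟩
  have e1 : (of I A r).val (k + m) * (Submodule.Quotient.mk s : A ⧸ (I ^ (k + m) • ⊤ : Submodule A A)) =
      Submodule.Quotient.mk (r * s) := by
    rw [of_apply, Submodule.mkQ_apply]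
    exact (map_mul (Ideal.Quotient.mk (I ^ (k + m) • ⊤ : Ideal A)) r s).symm
  have e2 : (of I A r).val k * (Submodule.Quotient.mk (D s) : A ⧸ (I ^ k • ⊤ : Submodule A A)) =
      Submodule.Quotient.mk (r * D s) := by
    rw [of_apply, Submodule.mkQ_apply]
    exact (map_mul (Ideal.Quotient.mk (I ^ k • ⊤ : Ideal A)) r (D s)).symm
  change g k ((of I A r).val (k + m) * Submodule.Quotient.mk s) -
      (of I A r).val k * g k (Submodule.Quotient.mk s) = _
  rw [e1, hg, hg, e2, commMul_apply, Submodule.Quotient.mk_sub]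

/-- Iterated commutators of a levelwise extension with elements `ι(rᵢ)` are levelwise extensions of the iterated
commutators downstairs. [folklore] -/
private theorem foldl_levelwise_of {m : ℕ} :
    ∀ (rs : List A) {E : A →ₗ[R] A} {G : AdicCompletion I A →ₗ[R] AdicCompletion I A}
      {g : ∀ k, A ⧸ (I ^ (k + m) • ⊤ : Submodule A A) → A ⧸ (I ^ k • ⊤ : Submodule A A)},
      (∀ (f : AdicCompletion I A) (k : ℕ), (G f).val k = g k (f.val (k + m))) →
      (∀ (k : ℕ) (s : A), g k (Submodule.Quotient.mk s) = Submodule.Quotient.mk (E s)) →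
      ∃ γ : ∀ k, A ⧸ (I ^ (k + m) • ⊤ : Submodule A A) → A ⧸ (I ^ k • ⊤ : Submodule A A),
        (∀ (f : AdicCompletion I A) (k : ℕ),
            (rs.foldl (fun G r => commMul R G (of I A r)) G f).val k = γ k (f.val (k + m))) ∧
        ∀ (k : ℕ) (s : A), γ k (Submodule.Quotient.mk s) =
          Submodule.Quotient.mk (rs.foldl (fun E r => commMul R E r) E s)
  | [], E, G, g, hG, hg => ⟨g, hG, hg⟩
  | r :: rs, E, G, g, hG, hg => by
    obtain ⟨g', hG', hg'⟩ := levelwise_commMul_of hG hg r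
    rw [List.foldl_cons, List.foldl_cons]
    exact foldl_levelwise_of rs hG' hg'

/-- **A differential operator of order `≤ n` extends to the `I`-adic completion as a differential operator of
order `≤ n`.** For `D : A → A` `R`-linear of order `≤ n` (EGA IV₄ 16.8.8 (b)) and any ideal `I ⊂ A` there is an
`R`-linear `D̂ : Â → Â` on `Â = AdicCompletion I A` with `D̂ (ι x) = ι (D x)` for all `x ∈ A` and
`IsDiffOpLE R n D̂`. Construction: `D(I^{k+n}) ⊆ I^k` (`IsDiffOpLE.apply_mem_pow_sub`) gives level maps
`A/I^{k+n} → A/I^k`; the order bound is checked by the levelwise criterion `isDiffOpLE_of_forall_list_of`, the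
iterated commutators with the `ι(rᵢ)` being the extensions of the iterated commutators of `D`, which vanish by
EGA IV₄ 16.8.8 (c). [cite: EGAIV4, Prop. 16.8.8 (b),(c)] -/
theorem IsDiffOpLE.exists_adicCompletion {n : ℕ} {D : A →ₗ[R] A} (hD : IsDiffOpLE R n D) (I : Ideal A) :
    ∃ G : AdicCompletion I A →ₗ[R] AdicCompletion I A,
      (∀ x : A, G (of I A x) = of I A (D x)) ∧ IsDiffOpLE R n G := by
  obtain ⟨G, g, hG, hg, hGof⟩ := exists_adicCompletion_extension_levelwise I D (m := n)
    (fun k x hx => by simpa only [Nat.add_sub_cancel] using hD.apply_mem_pow_sub I (k + n) hx)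
  refine ⟨G, hGof, isDiffOpLE_of_forall_list_of hG fun rs hlen => ?_⟩
  obtain ⟨γ, hγ, hγmk⟩ := foldl_levelwise_of rs hG hg
  have hzero : rs.foldl (fun E r => commMul R E r) D = 0 := isDiffOpLE_iff_forall_list.mp hD rs hlen
  ext f k
  rw [hγ, LinearMap.zero_apply, val_zero_apply]
  obtain ⟨s, hs⟩ := exists_val_eq_mk f (k + n)
  rw [hs, hγmk, hzero, LinearMap.zero_apply, Submodule.Quotient.mk_zero]

end Extension

end Literature.AlgebraicGeometry.Resolution
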